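import Literature.MathematicalPhysics.QuantumFieldTheory.Federbush1986.PhaseCellIVAppAStatements

/-!
# Federbush, *A phase cell approach to Yang–Mills theory. IV. The choice of variables* (CMP **114** (1988) 317–343) —
# Appendix A, part B «Geometric Constructions 2 and 4»: THEOREM A.2 (A.18)–(A.19) p. 341 under the EMBEDDED reading
# `M ⊆ Rᵗ`, PROVED for every uniformly Lipschitz-retractable `M` and, hypothesis-free, for the MODEL INSTANCE `M = S^{t−1}`

statement-level skeleton of published theorems with citation tags; proofs where landed; nothing here is a claim about the Yang–Mills mass gap

Cell `lit-balaban`, reader/typer block **r19** (F4 fold owner), SKELETON row `F4.ThmA.2`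
(`run/shared/lean/pub/lit-balaban/lit-balaban-r19/ROWS-F4.md`).

**Source.** P. Federbush, Commun. Math. Phys. **114** (1988) 317–343 [bib `Federbush1988PhaseCellIV`;
doi:10.1007/bf01225039; lit store `paper:doi-10-1007-bf01225039`; journal page = PDF page + 316], p. 341 [PDF 25] read as an
image (render `lit-balaban-r19/renders/f4/f4-p025.png`).  Verbatim, part B: «Let `M` be a compact differentiable manifold
(without boundary) and supplied with a metric. … Given two maps `g₁` and `g₂` into `M` we define `d^M(g₁, g₂) = sup_x d(g₁(x),
g₂(x))` (A.17).  With `B` the unit ball, we have given three maps `f₁ : ∂B → M`, `f₂ : ∂B → M`, `f₁^e : B → M`, where `f₁^e` is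
an extension of `f₁`.  **Theorem A.2.** If `d^M(f₁, f₂) ≤ ε_M`, with `ε_M` an absolute constant independent of the three maps,
then there is an extension `f₂^e` of `f₂` to the ball satisfying `d^M(f₁^e, f₂^e) ≤ c₁ d^M(f₁, f₂)` (A.18),
`Λ₁(f₂^e) ≤ c₂[Λ₁(f₁^e) + d^M(f₁, f₂) + Λ₁(f₂)]` (A.19), for some absolute constants `c₁` and `c₂`.»  Printed proof
(A.20)–(A.24): «Let `a = Min(d^M(f₁, f₂)/Λ₁(f₁^e), ½)` (A.20), then for `|x| ≤ 1 − a` we define `f₂^e(x) = f₁^e(x/(1 − a))`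
(A.21).  For `x` with `|x| = 1` and `1 − a ≤ r ≤ 1` (A.22) let `g(x, r)` be a point moving along the shortest geodesic in `M`
from `f₁(x)` to `f₂(x)` … at constant speed (A.23) … `f₂^e(rx) = g(x, r)` (A.24).»

**What this file does.**
* The decl of record of row F4.ThmA.2, `PhaseCellIVAppA.ThmA2` (p242861), is typed over Mathlib's ABSTRACT Riemannian-manifold
  class (`IsRiemannianManifold I M`, compact, boundaryless).  Mathlib presently carries no compact instance of that class other
  than (zero-dimensional) inner-product spaces, so no model instance of `ThmA2` can be inhabited.  Exactly as print does for
  Theorem A.3 (p. 342: «We now embed `M` in some Euclidean space `Rᵗ`, and view `f` as a map from `B` into `Rᵗ`») and as the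
  sibling statements `ThmA3`/`ThmA4` are typed, `ThmA2Emb n t M` below RE-READS Theorem A.2 for a target SET
  `M ⊆ EuclideanSpace ℝ (Fin t)` with the ambient distance (bi-Lipschitz to any Riemannian distance on a compact submanifold —
  the absolute constants absorb the comparison), all other features verbatim from `ThmA2`: `B`, `∂B` the closed unit ball and
  unit sphere of `ℝⁿ`, `d^M` = `supDist`, `Λ₁` = `lipConst` (both `ℝ≥0∞`-valued), `ε_M > 0`, `c₁`, `c₂` chosen BEFORE the three
  maps.
* `thmA2Emb_of_retract` PROVES `ThmA2Emb n t M` for every `n` whenever `M` is UNIFORMLY LIPSCHITZ-RETRACTABLE: there are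
  `r > 0` and a map `P`, `L`-Lipschitz on the open `r`-neighbourhood `{y | infDist y M < r}` of `M`, with values in `M` there and
  `P = id` on `M` (every compact `C²` submanifold is such, by the tubular-neighbourhood theorem; that theorem is not in Mathlib,
  so the retraction is carried as a hypothesis, as in `PhaseCellIVThmA3Retract`).  The proof IS print's construction
  (A.20)–(A.24) with ONE substitution: the «shortest geodesic from `f₁(x)` to `f₂(x)` at constant speed» (A.22)–(A.23) is
  replaced by the retracted chord `s ↦ P((1 − s) f₁(x) + s f₂(x))` (which needs `d^M(f₁, f₂) < r`, whence `ε_M = r/2`), and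
  print's `a = Min(d^M/Λ₁(f₁^e), ½)` by the equivalent-up-to-constants `a = d^M/(Λ₁(f₁^e) + 2 d^M)` (so that `0 < a ≤ ½`,
  `a Λ₁(f₁^e) ≤ d^M` and `d^M/a = Λ₁(f₁^e) + 2 d^M` hold without case distinctions).  Constants obtained: `ε_M = r/2`,
  `c₁ = 1 + L`, `c₂ = 2 + 9L`.  NO CAP on `Λ₁` is needed (contrast Theorems A.3/A.4, p. 339 «Caution», `ThmA3ContCap`):
  Theorem A.2 holds with absolute constants exactly as printed.  Degenerate cases print passes over are handled: `Λ₁(f₁^e) = ∞`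
  (then (A.19) is void and `f₂^e := f₁^e` inside, `f₂` on `∂B` gives (A.18) with `c₁ ≥ 1`), `d^M(f₁, f₂) = 0` (then `f₂ = f₁`,
  `f₂^e := f₁^e`), `Λ₁(f₂) = ∞`, `n = 0`.
* MODEL INSTANCE, hypothesis-free: `thmA2Emb_sphere (n t) : ThmA2Emb n t (sphere 0 1)` — the round sphere `S^{t−1} ⊂ ℝᵗ` with the
  radial retraction `P y = y/|y|` (`r = ½`, `L = 4`); in particular `U(1) = S¹ ⊂ ℝ²` (`thmA2Emb_circle`) and
  `SU(2) ≅ S³ ⊂ ℝ⁴` (`thmA2Emb_threeSphere`), the gauge groups of the series.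
-/

namespace Literature.MathematicalPhysics.QuantumFieldTheory.Federbush1986

noncomputable section

open scoped NNReal ENNReal
open Set Metric

namespace PhaseCellIVAppA

/-! ## 1. Theorem A.2 under the embedded reading `M ⊆ Rᵗ` -/

/-- **Theorem A.2** p. 341 (verbatim in the module docstring), EMBEDDED READING: the target is a set
`M ⊆ EuclideanSpace ℝ (Fin t)` carrying the ambient distance (print, p. 342: «We now embed `M` in some Euclidean space `Rᵗ`»;
same device as `ThmA3`/`ThmA4`), `B`/`∂B` the closed unit ball / unit sphere of `ℝⁿ`, `d^M` = `supDist` (A.17), `Λ₁` =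
`lipConst` (11.4); «`ε_M` an absolute constant independent of the three maps», «absolute constants `c₁` and `c₂`» = chosen
before `f₁`, `f₂`, `f₁^e`; (A.18)–(A.19) as inequalities in `ℝ≥0∞`.  Word for word the statement `ThmA2` with the abstract
Riemannian manifold replaced by the embedded `M`.  A `Prop`-valued definition (proved below for uniformly Lipschitz-retractable
`M`, in particular for spheres). [cite: Federbush1988PhaseCellIV, Theorem A.2 (A.17)–(A.19) p. 341; p. 342] -/
def ThmA2Emb (n t : ℕ) (M : Set (EuclideanSpace ℝ (Fin t))) : Prop :=
  ∃ εM : ℝ≥0, 0 < εM ∧ ∃ c₁ c₂ : ℝ≥0,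
    ∀ (f₁ f₂ : ↥(sphere (0 : EuclideanSpace ℝ (Fin n)) 1) → ↥M)
      (f₁e : ↥(closedBall (0 : EuclideanSpace ℝ (Fin n)) 1) → ↥M),
      (∀ x : ↥(sphere (0 : EuclideanSpace ℝ (Fin n)) 1), f₁e ⟨x.1, sphere_subset_closedBall x.2⟩ = f₁ x) →
      supDist f₁ f₂ ≤ εM →
      ∃ f₂e : ↥(closedBall (0 : EuclideanSpace ℝ (Fin n)) 1) → ↥M,
        (∀ x : ↥(sphere (0 : EuclideanSpace ℝ (Fin n)) 1), f₂e ⟨x.1, sphere_subset_closedBall x.2⟩ = f₂ x) ∧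
        supDist f₁e f₂e ≤ c₁ * supDist f₁ f₂ ∧
        lipConst f₂e ≤ c₂ * (lipConst f₁e + supDist f₁ f₂ + lipConst f₂)

/-! ## 2. The radial projection `x ↦ x/|x|` (used twice: `x ↦ x/|x|` in (A.22)–(A.24), and as the retraction onto a sphere) -/

namespace ThmA2

section Radial

variable {V : Type*} [NormedAddCommGroup V] [NormedSpace ℝ V]

/-- `x/|x|` (the direction of `x`; (A.24): «`f₂^e(rx) = g(x, r)`», `|x| = 1`, i.e. `f₂^e(y) = g(y/|y|, |y|)`).
[cite: Federbush1988PhaseCellIV, (A.22)–(A.24) p. 341] -/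
def radial (x : V) : V := ‖x‖⁻¹ • x

/-- `|x/|x|| = 1` for `x ≠ 0`. [cite: Federbush1988PhaseCellIV, (A.22) p. 341] -/
theorem norm_radial {x : V} (hx : x ≠ 0) : ‖radial x‖ = 1 := by
  rw [radial, norm_smul, norm_inv, norm_norm, inv_mul_cancel₀ (norm_ne_zero_iff.mpr hx)]

/-- On the unit sphere `x/|x| = x`. [cite: Federbush1988PhaseCellIV, (A.22) p. 341] -/
theorem radial_of_norm_eq_one {x : V} (hx : ‖x‖ = 1) : radial x = x := by
  rw [radial, hx, inv_one, one_smul]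

/-- `|x − x/|x|| = 1 − |x|` inside the unit ball («`f₂^e(rx)`, `1 − a ≤ r ≤ 1`», (A.22)/(A.24)).
[cite: Federbush1988PhaseCellIV, (A.22), (A.24) p. 341] -/
theorem norm_sub_radial {x : V} (hx : x ≠ 0) (h1 : ‖x‖ ≤ 1) : ‖x - radial x‖ = 1 - ‖x‖ := by
  have hn : 0 < ‖x‖ := norm_pos_iff.mpr hx
  have h : x - radial x = (1 - ‖x‖⁻¹) • x := by rw [radial, sub_smul, one_smul]
  rw [h, norm_smul, Real.norm_eq_abs, abs_of_nonpos (by rw [sub_nonpos]; exact one_le_inv_iff₀.mpr ⟨hn, h1⟩)]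
  field_simp
  ring

/-- The direction map is `2/ρ`-Lipschitz outside the ball of radius `ρ`:  `|x/|x| − y/|y|| ≤ (2/ρ)|x − y|` for `|x|, |y| ≥ ρ`.
[cite: Federbush1988PhaseCellIV, (A.22)–(A.24) p. 341] -/
theorem norm_radial_sub_radial_le {x y : V} {ρ : ℝ} (hρ : 0 < ρ) (hx : ρ ≤ ‖x‖) (hy : ρ ≤ ‖y‖) :
    ‖radial x - radial y‖ ≤ 2 / ρ * ‖x - y‖ := by
  have hx0 : 0 < ‖x‖ := hρ.trans_le hx
  have hy0 : 0 < ‖y‖ := hρ.trans_le hy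
  have h1 : radial x - radial y = ‖x‖⁻¹ • (x - y) + (‖x‖⁻¹ - ‖y‖⁻¹) • y := by
    simp only [radial, smul_sub, sub_smul, sub_add_sub_cancel]
  have h2 : |‖x‖⁻¹ - ‖y‖⁻¹| * ‖y‖ = ‖x‖⁻¹ * |‖y‖ - ‖x‖| := by
    rw [show ‖x‖⁻¹ - ‖y‖⁻¹ = (‖y‖ - ‖x‖) * (‖x‖⁻¹ * ‖y‖⁻¹) by field_simp, abs_mul,
      abs_of_pos (mul_pos (inv_pos.2 hx0) (inv_pos.2 hy0))]
    field_simp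
  rw [h1]
  calc ‖‖x‖⁻¹ • (x - y) + (‖x‖⁻¹ - ‖y‖⁻¹) • y‖
      ≤ ‖‖x‖⁻¹ • (x - y)‖ + ‖(‖x‖⁻¹ - ‖y‖⁻¹) • y‖ := norm_add_le _ _
    _ = ‖x‖⁻¹ * ‖x - y‖ + ‖x‖⁻¹ * |‖y‖ - ‖x‖| := by
        rw [norm_smul, norm_smul, norm_inv, norm_norm, Real.norm_eq_abs, h2]
    _ ≤ ‖x‖⁻¹ * ‖x - y‖ + ‖x‖⁻¹ * ‖x - y‖ := by
        gcongr
        rw [abs_sub_comm]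
        exact abs_norm_sub_norm_le x y
    _ = 2 / ‖x‖ * ‖x - y‖ := by ring
    _ ≤ 2 / ρ * ‖x - y‖ := by gcongr

end Radial

/-! ## 3. Gluing two Lipschitz bounds across a sphere (the two regions `|x| ≤ 1 − a` / `1 − a ≤ |x| ≤ 1` of (A.21)/(A.24)) -/

/-- If `g` is `K`-Lipschitz on `{|x| ≤ ρ}` and on `{ρ ≤ |x| ≤ 1}` then it is `K`-Lipschitz on the closed unit ball: a segment
from the inner region to the outer one crosses the sphere `|x| = ρ` (intermediate value theorem), and the two bounds add up along
the segment.  (The step print leaves implicit when it defines `f₂^e` by the two formulas (A.21) and (A.24).)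
[cite: Federbush1988PhaseCellIV, (A.21), (A.24) p. 341] -/
theorem lipschitzOnWith_closedBall_of_glue {V W : Type*} [NormedAddCommGroup V] [NormedSpace ℝ V]
    [PseudoMetricSpace W] {g : V → W} {K : ℝ≥0} {ρ : ℝ}
    (h₁ : LipschitzOnWith K g {x | ‖x‖ ≤ ρ})
    (h₂ : LipschitzOnWith K g {x | ρ ≤ ‖x‖ ∧ ‖x‖ ≤ 1}) :
    LipschitzOnWith K g (closedBall 0 1) := by
  have key : ∀ x y : V, ‖x‖ ≤ ρ → ρ ≤ ‖y‖ → ‖y‖ ≤ 1 → dist (g x) (g y) ≤ K * dist x y := by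
    intro x y hx hy hy1
    set γ : ℝ → V := fun s => x + s • (y - x) with hγ
    have hcont : Continuous fun s => ‖γ s‖ := by
      simp only [hγ]
      fun_prop
    have h0 : ‖γ 0‖ ≤ ρ := by simp [hγ, hx]
    have h1 : ρ ≤ ‖γ 1‖ := by simp [hγ, hy]
    obtain ⟨s, hs, hsρ⟩ : ∃ s ∈ Icc (0 : ℝ) 1, ‖γ s‖ = ρ :=
      intermediate_value_Icc zero_le_one hcont.continuousOn ⟨h0, h1⟩
    have hw₁ : γ s ∈ {x : V | ‖x‖ ≤ ρ} := le_of_eq hsρ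
    have hw₂ : γ s ∈ {x : V | ρ ≤ ‖x‖ ∧ ‖x‖ ≤ 1} := ⟨ge_of_eq hsρ, hsρ.le.trans (hy.trans hy1)⟩
    have e1 : dist x (γ s) = s * dist x y := by
      rw [dist_eq_norm, dist_eq_norm, hγ]
      simp only
      rw [show x - (x + s • (y - x)) = s • (x - y) by simp only [smul_sub]; abel, norm_smul,
        Real.norm_of_nonneg hs.1]
    have e2 : dist (γ s) y = (1 - s) * dist x y := by
      rw [dist_eq_norm, dist_eq_norm, hγ]
      simp only
      rw [show x + s • (y - x) - y = (1 - s) • (x - y) by simp only [sub_smul, one_smul, smul_sub]; abel,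
        norm_smul, Real.norm_of_nonneg (sub_nonneg.mpr hs.2)]
    calc dist (g x) (g y) ≤ dist (g x) (g (γ s)) + dist (g (γ s)) (g y) := dist_triangle _ _ _
      _ ≤ K * dist x (γ s) + K * dist (γ s) y :=
          add_le_add (h₁.dist_le_mul x hx _ hw₁) (h₂.dist_le_mul _ hw₂ y ⟨hy, hy1⟩)
      _ = K * dist x y := by rw [e1, e2]; ring
  refine LipschitzOnWith.of_dist_le_mul fun x hx y hy => ?_
  rw [mem_closedBall, dist_zero_right] at hx hy
  rcases le_or_gt ‖x‖ ρ with hxρ | hxρ <;> rcases le_or_gt ‖y‖ ρ with hyρ | hyρ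
  · exact h₁.dist_le_mul x hxρ y hyρ
  · exact key x y hxρ hyρ.le hy
  · rw [dist_comm (g x), dist_comm x]
    exact key y x hyρ hxρ.le hx
  · exact h₂.dist_le_mul x ⟨hxρ.le, hx⟩ y ⟨hyρ.le, hy⟩

/-! ## 4. The construction (A.20)–(A.24), with the retracted chord in place of the shortest geodesic -/

section Construction

variable {n t : ℕ}

/-- The time parameter along the geodesic/chord: for `1 − a ≤ |y| ≤ 1`, `s(y) = (|y| − (1 − a))/a ∈ [0, 1]` (print's «point
moving … from `f₁(x)` to `f₂(x)` as `r` varies from `1 − a` to `1`, and at constant speed» (A.23)).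
[cite: Federbush1988PhaseCellIV, (A.22)–(A.23) p. 341] -/
def sPar (a : ℝ) (y : EuclideanSpace ℝ (Fin n)) : ℝ := (‖y‖ - (1 - a)) / a

/-- The outer formula (A.24) «`f₂^e(rx) = g(x, r)`», with `g(x, ·)` the RETRACTED CHORD
`s ↦ P(f₁(x) + s (f₂(x) − f₁(x)))` in place of the shortest geodesic: `y ↦ P(F₁(y/|y|) + s(y) (F₂(y/|y|) − F₁(y/|y|)))`.
[cite: Federbush1988PhaseCellIV, (A.22)–(A.24) p. 341] -/
def outerMap (P : EuclideanSpace ℝ (Fin t) → EuclideanSpace ℝ (Fin t))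
    (F₁ F₂ : EuclideanSpace ℝ (Fin n) → EuclideanSpace ℝ (Fin t)) (a : ℝ) (y : EuclideanSpace ℝ (Fin n)) :
    EuclideanSpace ℝ (Fin t) :=
  P (F₁ (radial y) + sPar a y • (F₂ (radial y) - F₁ (radial y)))

/-- The extension `f₂^e` of (A.21)/(A.24): «for `|x| ≤ 1 − a` we define `f₂^e(x) = f₁^e(x/(1 − a))` (A.21)», and the outer
formula on `1 − a ≤ |x| ≤ 1`. [cite: Federbush1988PhaseCellIV, (A.21), (A.24) p. 341] -/
def extMap (P : EuclideanSpace ℝ (Fin t) → EuclideanSpace ℝ (Fin t))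
    (F₁ F₂ : EuclideanSpace ℝ (Fin n) → EuclideanSpace ℝ (Fin t)) (a : ℝ) (y : EuclideanSpace ℝ (Fin n)) :
    EuclideanSpace ℝ (Fin t) :=
  if ‖y‖ ≤ 1 - a then F₁ ((1 - a)⁻¹ • y) else outerMap P F₁ F₂ a y

variable {M : Set (EuclideanSpace ℝ (Fin t))} {P : EuclideanSpace ℝ (Fin t) → EuclideanSpace ℝ (Fin t)}
  {F₁ F₂ : EuclideanSpace ℝ (Fin n) → EuclideanSpace ℝ (Fin t)} {a r : ℝ} {L Λ Λ₂ d : ℝ≥0}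

/-- For `y` in the outer region `1 − a < |y| ≤ 1` (`0 < a ≤ ½`): `y ≠ 0`, `y/|y| ∈ ∂B` and `0 ≤ s(y) ≤ 1`.
[cite: Federbush1988PhaseCellIV, (A.22) p. 341] -/
theorem outer_facts (ha0 : 0 < a) (ha1 : a ≤ 1 / 2) {y : EuclideanSpace ℝ (Fin n)} (hy : 1 - a < ‖y‖) (hy1 : ‖y‖ ≤ 1) :
    y ≠ 0 ∧ radial y ∈ sphere (0 : EuclideanSpace ℝ (Fin n)) 1 ∧ 0 ≤ sPar a y ∧ sPar a y ≤ 1 := by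
  have hy0 : y ≠ 0 := by
    intro h
    rw [h, norm_zero] at hy
    linarith
  refine ⟨hy0, by rw [mem_sphere_zero_iff_norm, norm_radial hy0], div_nonneg (by linarith) ha0.le, ?_⟩
  rw [sPar, div_le_one ha0]
  linarith

/-- The chord point `z = F₁(u) + s (F₂(u) − F₁(u))`, `u ∈ ∂B`, `0 ≤ s ≤ 1`, lies within `d^M(f₁, f₂)` of `F₁(u) ∈ M`, hence in
the `r`-neighbourhood of `M` as soon as `d^M(f₁, f₂) < r` (the rôle of «`d^M(f₁, f₂) ≤ ε_M`»).
[cite: Federbush1988PhaseCellIV, Theorem A.2 p. 341] -/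
theorem infDist_chord_lt (hF₁M : MapsTo F₁ (closedBall 0 1) M)
    (hd : ∀ u ∈ sphere (0 : EuclideanSpace ℝ (Fin n)) 1, ‖F₂ u - F₁ u‖ ≤ d) (hdr : (d : ℝ) < r)
    {u : EuclideanSpace ℝ (Fin n)} (hu : u ∈ sphere (0 : EuclideanSpace ℝ (Fin n)) 1) {s : ℝ} (hs0 : 0 ≤ s) (hs1 : s ≤ 1) :
    infDist (F₁ u + s • (F₂ u - F₁ u)) M < r := by
  have hmem : F₁ u ∈ M := hF₁M (sphere_subset_closedBall hu)
  calc infDist (F₁ u + s • (F₂ u - F₁ u)) M ≤ dist (F₁ u + s • (F₂ u - F₁ u)) (F₁ u) := infDist_le_dist_of_mem hmem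
    _ = s * ‖F₂ u - F₁ u‖ := by rw [dist_eq_norm, add_sub_cancel_left, norm_smul, Real.norm_of_nonneg hs0]
    _ ≤ 1 * d := by gcongr; exact hd u hu
    _ < r := by rw [one_mul]; exact hdr

/-- On the interface `|y| = 1 − a` the two formulas agree, so `f₂^e` equals the outer formula on the CLOSED outer region
`1 − a ≤ |y| ≤ 1` (at `s = 0` the chord starts at `f₁^e(y/|y|) = f₁^e(y/(1 − a)) ∈ M`, fixed by `P`).
[cite: Federbush1988PhaseCellIV, (A.21)–(A.24) p. 341] -/
theorem extMap_eq_outerMap (ha0 : 0 < a) (ha1 : a ≤ 1 / 2) (hF₁M : MapsTo F₁ (closedBall 0 1) M)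
    (hPid : ∀ z ∈ M, P z = z) {y : EuclideanSpace ℝ (Fin n)} (hy : 1 - a ≤ ‖y‖) :
    extMap P F₁ F₂ a y = outerMap P F₁ F₂ a y := by
  unfold extMap
  split_ifs with h
  · have heq : ‖y‖ = 1 - a := le_antisymm h hy
    have hy0 : y ≠ 0 := by
      intro h0
      rw [h0, norm_zero] at heq
      linarith
    have hrad : (1 - a)⁻¹ • y = radial y := by rw [radial, heq]
    have hs : sPar a y = 0 := by rw [sPar, heq, sub_self, zero_div]
    have hmem : F₁ (radial y) ∈ M :=
      hF₁M (sphere_subset_closedBall (by rw [mem_sphere_zero_iff_norm, norm_radial hy0]))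
    rw [outerMap, hs, zero_smul, add_zero, hPid _ hmem, hrad]
  · rfl

/-- `f₂^e` takes values in `M` on the closed unit ball (inner region: values of `f₁^e`; outer region: values of `P`).
[cite: Federbush1988PhaseCellIV, Theorem A.2 p. 341] -/
theorem extMap_mem (ha0 : 0 < a) (ha1 : a ≤ 1 / 2) (hF₁M : MapsTo F₁ (closedBall 0 1) M)
    (hPM : MapsTo P {z | infDist z M < r} M)
    (hd : ∀ u ∈ sphere (0 : EuclideanSpace ℝ (Fin n)) 1, ‖F₂ u - F₁ u‖ ≤ d) (hdr : (d : ℝ) < r)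
    {y : EuclideanSpace ℝ (Fin n)} (hy1 : ‖y‖ ≤ 1) : extMap P F₁ F₂ a y ∈ M := by
  unfold extMap
  split_ifs with h
  · apply hF₁M
    rw [mem_closedBall, dist_zero_right, norm_smul, norm_inv, Real.norm_of_nonneg (by linarith)]
    rw [inv_mul_le_iff₀ (by linarith)]
    linarith
  · obtain ⟨_, hu, hs0, hs1⟩ := outer_facts ha0 ha1 (lt_of_not_ge h) hy1
    exact hPM (infDist_chord_lt hF₁M hd hdr hu hs0 hs1)

/-- `f₂^e` extends `f₂`: on `∂B`, `s = 1` and the chord ends at `f₂(x) ∈ M`, fixed by `P` («an extension `f₂^e` of `f₂` to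
the ball»). [cite: Federbush1988PhaseCellIV, Theorem A.2 p. 341] -/
theorem extMap_of_norm_eq_one (ha0 : 0 < a) (hF₂M : MapsTo F₂ (sphere 0 1) M) (hPid : ∀ z ∈ M, P z = z)
    {y : EuclideanSpace ℝ (Fin n)} (hy : ‖y‖ = 1) : extMap P F₁ F₂ a y = F₂ y := by
  unfold extMap
  rw [if_neg (by rw [hy]; linarith), outerMap, radial_of_norm_eq_one hy,
    show sPar a y = 1 by rw [sPar, hy, sub_sub_cancel, div_self ha0.ne'], one_smul, add_sub_cancel,
    hPid _ (hF₂M (by rw [mem_sphere_zero_iff_norm, hy]))]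

/-- **(A.18)** pointwise: `|f₁^e(y) − f₂^e(y)| ≤ (1 + L) d^M(f₁, f₂)` on `B`.  Inner region: `|f₁^e(y) − f₁^e(y/(1 − a))| ≤
Λ₁(f₁^e) · a|y|/(1 − a) ≤ a Λ₁(f₁^e) ≤ d^M`; outer region: `|f₁^e(y) − f₁^e(y/|y|)| ≤ Λ₁(f₁^e)(1 − |y|) ≤ a Λ₁(f₁^e) ≤ d^M` and
`|P(f₁(u)) − P(z)| ≤ L s |f₂(u) − f₁(u)| ≤ L d^M`. [cite: Federbush1988PhaseCellIV, (A.18), (A.20)–(A.24) p. 341] -/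
theorem dist_extMap_le (ha0 : 0 < a) (ha1 : a ≤ 1 / 2) (hΛa : (Λ : ℝ) * a ≤ d)
    (hF₁ : LipschitzOnWith Λ F₁ (closedBall 0 1)) (hF₁M : MapsTo F₁ (closedBall 0 1) M)
    (hPL : LipschitzOnWith L P {z | infDist z M < r}) (hPid : ∀ z ∈ M, P z = z)
    (hd : ∀ u ∈ sphere (0 : EuclideanSpace ℝ (Fin n)) 1, ‖F₂ u - F₁ u‖ ≤ d) (hdr : (d : ℝ) < r)
    {y : EuclideanSpace ℝ (Fin n)} (hy1 : ‖y‖ ≤ 1) :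
    dist (F₁ y) (extMap P F₁ F₂ a y) ≤ (1 + L) * d := by
  have hyB : y ∈ closedBall (0 : EuclideanSpace ℝ (Fin n)) 1 := by rwa [mem_closedBall, dist_zero_right]
  have hLd : (d : ℝ) ≤ (1 + L) * d := by
    have : (0 : ℝ) ≤ L * d := by positivity
    linarith
  unfold extMap
  split_ifs with h
  · have h1a : 0 < 1 - a := by linarith
    have hmem : (1 - a)⁻¹ • y ∈ closedBall (0 : EuclideanSpace ℝ (Fin n)) 1 := by
      rw [mem_closedBall, dist_zero_right, norm_smul, norm_inv, Real.norm_of_nonneg h1a.le,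
        inv_mul_le_iff₀ h1a]
      linarith
    have hcoef : |1 - (1 - a)⁻¹| = a / (1 - a) := by
      rw [abs_of_nonpos (by rw [sub_nonpos, one_le_inv_iff₀]; constructor <;> linarith)]
      field_simp
      ring
    have hmono : a / (1 - a) * ‖y‖ ≤ a / (1 - a) * (1 - a) :=
      mul_le_mul_of_nonneg_left h (div_nonneg ha0.le h1a.le)
    calc dist (F₁ y) (F₁ ((1 - a)⁻¹ • y)) ≤ Λ * dist y ((1 - a)⁻¹ • y) := hF₁.dist_le_mul y hyB _ hmem
      _ = Λ * (a / (1 - a) * ‖y‖) := by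
          rw [dist_eq_norm, show y - (1 - a)⁻¹ • y = (1 - (1 - a)⁻¹) • y by rw [sub_smul, one_smul], norm_smul,
            Real.norm_eq_abs, hcoef]
      _ ≤ Λ * (a / (1 - a) * (1 - a)) := by gcongr
      _ = Λ * a := by rw [div_mul_cancel₀ _ h1a.ne']
      _ ≤ (1 + L) * d := hΛa.trans hLd
  · obtain ⟨hy0, hu, hs0, hs1⟩ := outer_facts ha0 ha1 (lt_of_not_ge h) hy1
    have huB : radial y ∈ closedBall (0 : EuclideanSpace ℝ (Fin n)) 1 := sphere_subset_closedBall hu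
    have hmemM : F₁ (radial y) ∈ M := hF₁M huB
    have hU₁ : F₁ (radial y) ∈ {z | infDist z M < r} := by
      show infDist (F₁ (radial y)) M < r
      rw [infDist_zero_of_mem hmemM]
      exact lt_of_le_of_lt d.2 hdr
    have hU₂ : F₁ (radial y) + sPar a y • (F₂ (radial y) - F₁ (radial y)) ∈ {z | infDist z M < r} :=
      infDist_chord_lt hF₁M hd hdr hu hs0 hs1
    calc dist (F₁ y) (outerMap P F₁ F₂ a y)
        ≤ dist (F₁ y) (F₁ (radial y)) + dist (F₁ (radial y)) (outerMap P F₁ F₂ a y) := dist_triangle _ _ _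
      _ ≤ Λ * dist y (radial y) + L * dist (F₁ (radial y)) (F₁ (radial y) + sPar a y • (F₂ (radial y) - F₁ (radial y))) := by
          refine add_le_add (hF₁.dist_le_mul y hyB _ huB) ?_
          rw [outerMap]
          nth_rw 1 [← hPid _ hmemM]
          exact hPL.dist_le_mul _ hU₁ _ hU₂
      _ = Λ * (1 - ‖y‖) + L * (sPar a y * ‖F₂ (radial y) - F₁ (radial y)‖) := by
          rw [dist_eq_norm, norm_sub_radial hy0 hy1, dist_eq_norm,
            show F₁ (radial y) - (F₁ (radial y) + sPar a y • (F₂ (radial y) - F₁ (radial y))) =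
              -(sPar a y • (F₂ (radial y) - F₁ (radial y))) by abel,
            norm_neg, norm_smul, Real.norm_of_nonneg hs0]
      _ ≤ Λ * a + L * (1 * d) := by
          gcongr
          · linarith [lt_of_not_ge h]
          · exact hd _ hu
      _ ≤ (1 + L) * d := by rw [one_mul]; linarith

/-- `f₂^e` is `2Λ₁(f₁^e)`-Lipschitz on the inner region `|y| ≤ 1 − a` ((A.21): a rescaling by `1/(1 − a) ≤ 2`).
[cite: Federbush1988PhaseCellIV, (A.21) p. 341] -/
theorem lipschitzOnWith_extMap_inner (ha0 : 0 < a) (ha1 : a ≤ 1 / 2) (hF₁ : LipschitzOnWith Λ F₁ (closedBall 0 1)) :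
    LipschitzOnWith (2 * Λ) (extMap P F₁ F₂ a) {y : EuclideanSpace ℝ (Fin n) | ‖y‖ ≤ 1 - a} := by
  have hsc : ∀ y : EuclideanSpace ℝ (Fin n), ‖y‖ ≤ 1 - a → (1 - a)⁻¹ • y ∈ closedBall (0 : EuclideanSpace ℝ (Fin n)) 1 := by
    intro y hy
    rw [mem_closedBall, dist_zero_right, norm_smul, norm_inv, Real.norm_of_nonneg (by linarith),
      inv_mul_le_iff₀ (by linarith)]
    linarith
  refine LipschitzOnWith.of_dist_le_mul fun x hx y hy => ?_
  have hx' : ‖x‖ ≤ 1 - a := hx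
  have hy' : ‖y‖ ≤ 1 - a := hy
  simp only [extMap, if_pos hx', if_pos hy']
  calc dist (F₁ ((1 - a)⁻¹ • x)) (F₁ ((1 - a)⁻¹ • y)) ≤ Λ * dist ((1 - a)⁻¹ • x) ((1 - a)⁻¹ • y) :=
        hF₁.dist_le_mul _ (hsc x hx') _ (hsc y hy')
    _ = Λ * ((1 - a)⁻¹ * dist x y) := by
        rw [dist_eq_norm, dist_eq_norm, ← smul_sub, norm_smul, norm_inv, Real.norm_of_nonneg (by linarith)]
    _ ≤ Λ * (2 * dist x y) := by
        gcongr
        rw [inv_le_comm₀ (by linarith) (by norm_num)]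
        linarith
    _ = (2 * Λ : ℝ≥0) * dist x y := by push_cast; ring

/-- `f₂^e` is Lipschitz on the outer region `1 − a ≤ |y| ≤ 1` with constant `L(9Λ₁(f₁^e) + 4Λ₁(f₂) + 2d^M)` (given
`d^M ≤ a(Λ₁(f₁^e) + 2d^M)`, i.e. print's `1/a ≲ Λ₁(f₁^e)/d^M`): the chord point `z(y) = F₁(u) + s(y)(F₂(u) − F₁(u))`, `u = y/|y|`,
moves by at most `Λ₁|u − u′| + |s − s′| d^M + (Λ₁(f₂) + Λ₁(f₁^e))|u − u′|`, with `|u − u′| ≤ 4|y − y′|` (`|y| ≥ ½`) and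
`|s − s′| ≤ |y − y′|/a`; then `P` costs the factor `L` — the three terms of (A.19).
[cite: Federbush1988PhaseCellIV, (A.19), (A.22)–(A.24) p. 341] -/
theorem lipschitzOnWith_outerMap (ha0 : 0 < a) (ha1 : a ≤ 1 / 2) (hda : (d : ℝ) ≤ a * (Λ + 2 * d))
    (hF₁ : LipschitzOnWith Λ F₁ (closedBall 0 1)) (hF₂ : LipschitzOnWith Λ₂ F₂ (sphere 0 1))
    (hF₁M : MapsTo F₁ (closedBall 0 1) M) (hPL : LipschitzOnWith L P {z | infDist z M < r})
    (hd : ∀ u ∈ sphere (0 : EuclideanSpace ℝ (Fin n)) 1, ‖F₂ u - F₁ u‖ ≤ d) (hdr : (d : ℝ) < r) :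
    LipschitzOnWith (L * (9 * Λ + 4 * Λ₂ + 2 * d)) (outerMap P F₁ F₂ a)
      {y : EuclideanSpace ℝ (Fin n) | 1 - a ≤ ‖y‖ ∧ ‖y‖ ≤ 1} := by
  refine LipschitzOnWith.of_dist_le_mul fun x hx y hy => ?_
  obtain ⟨hx, hx1⟩ := hx
  obtain ⟨hy, hy1⟩ := hy
  have hxpos : 0 < ‖x‖ := by linarith
  have hypos : 0 < ‖y‖ := by linarith
  have hx0 : x ≠ 0 := norm_pos_iff.mp hxpos
  have hy0 : y ≠ 0 := norm_pos_iff.mp hypos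
  have hux : radial x ∈ sphere (0 : EuclideanSpace ℝ (Fin n)) 1 := by rw [mem_sphere_zero_iff_norm, norm_radial hx0]
  have huy : radial y ∈ sphere (0 : EuclideanSpace ℝ (Fin n)) 1 := by rw [mem_sphere_zero_iff_norm, norm_radial hy0]
  have hsx0 : 0 ≤ sPar a x := div_nonneg (by linarith) ha0.le
  have hsx1 : sPar a x ≤ 1 := by rw [sPar, div_le_one ha0]; linarith
  have hsy0 : 0 ≤ sPar a y := div_nonneg (by linarith) ha0.le
  have hsy1 : sPar a y ≤ 1 := by rw [sPar, div_le_one ha0]; linarith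
  -- the direction and the time parameter are Lipschitz
  have hrad : ‖radial x - radial y‖ ≤ 4 * ‖x - y‖ := by
    have h := norm_radial_sub_radial_le (x := x) (y := y) (ρ := 1 / 2) (by norm_num) (by linarith) (by linarith)
    norm_num at h
    exact h
  have hs : |sPar a x - sPar a y| ≤ a⁻¹ * ‖x - y‖ := by
    rw [sPar, sPar, ← sub_div, abs_div, abs_of_pos ha0, div_eq_inv_mul,
      show ‖x‖ - (1 - a) - (‖y‖ - (1 - a)) = ‖x‖ - ‖y‖ by ring]
    gcongr
    exact abs_norm_sub_norm_le x y
  -- the chord points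
  set ux := radial x with hux_def
  set uy := radial y with huy_def
  set wx : EuclideanSpace ℝ (Fin t) := F₂ ux - F₁ ux with hwx
  set wy : EuclideanSpace ℝ (Fin t) := F₂ uy - F₁ uy with hwy
  have hF₁u : ‖F₁ ux - F₁ uy‖ ≤ Λ * ‖ux - uy‖ := by
    rw [← dist_eq_norm, ← dist_eq_norm]
    exact hF₁.dist_le_mul _ (sphere_subset_closedBall hux) _ (sphere_subset_closedBall huy)
  have hF₂u : ‖F₂ ux - F₂ uy‖ ≤ Λ₂ * ‖ux - uy‖ := by
    rw [← dist_eq_norm, ← dist_eq_norm]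
    exact hF₂.dist_le_mul _ hux _ huy
  have hw : ‖wx - wy‖ ≤ (Λ₂ + Λ) * ‖ux - uy‖ := by
    rw [hwx, hwy, show F₂ ux - F₁ ux - (F₂ uy - F₁ uy) = (F₂ ux - F₂ uy) - (F₁ ux - F₁ uy) by abel]
    calc ‖F₂ ux - F₂ uy - (F₁ ux - F₁ uy)‖ ≤ ‖F₂ ux - F₂ uy‖ + ‖F₁ ux - F₁ uy‖ := norm_sub_le _ _
      _ ≤ Λ₂ * ‖ux - uy‖ + Λ * ‖ux - uy‖ := add_le_add hF₂u hF₁u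
      _ = (Λ₂ + Λ) * ‖ux - uy‖ := by ring
  have hz : ‖(F₁ ux + sPar a x • wx) - (F₁ uy + sPar a y • wy)‖ ≤ (9 * Λ + 4 * Λ₂ + 2 * d) * ‖x - y‖ := by
    have hsplit : (F₁ ux + sPar a x • wx) - (F₁ uy + sPar a y • wy) =
        (F₁ ux - F₁ uy) + ((sPar a x - sPar a y) • wx + sPar a y • (wx - wy)) := by
      simp only [sub_smul, smul_sub]
      abel
    rw [hsplit]
    calc ‖(F₁ ux - F₁ uy) + ((sPar a x - sPar a y) • wx + sPar a y • (wx - wy))‖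
        ≤ ‖F₁ ux - F₁ uy‖ + (‖(sPar a x - sPar a y) • wx‖ + ‖sPar a y • (wx - wy)‖) := by
          refine (norm_add_le _ _).trans ?_
          gcongr
          exact norm_add_le _ _
      _ = ‖F₁ ux - F₁ uy‖ + (|sPar a x - sPar a y| * ‖wx‖ + sPar a y * ‖wx - wy‖) := by
          rw [norm_smul, norm_smul, Real.norm_eq_abs, Real.norm_of_nonneg hsy0]
      _ ≤ Λ * ‖ux - uy‖ + (a⁻¹ * ‖x - y‖ * d + 1 * ((Λ₂ + Λ) * ‖ux - uy‖)) := by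
          gcongr
          · exact hd _ hux
      _ ≤ Λ * (4 * ‖x - y‖) + (a⁻¹ * ‖x - y‖ * d + 1 * ((Λ₂ + Λ) * (4 * ‖x - y‖))) := by gcongr
      _ = (8 * Λ + 4 * Λ₂ + a⁻¹ * d) * ‖x - y‖ := by ring
      _ ≤ (8 * Λ + 4 * Λ₂ + (Λ + 2 * d)) * ‖x - y‖ := by
          gcongr
          rw [inv_mul_le_iff₀ ha0]
          exact hda
      _ = (9 * Λ + 4 * Λ₂ + 2 * d) * ‖x - y‖ := by ring
  -- apply the retraction
  have hU : ∀ {u : EuclideanSpace ℝ (Fin n)} {s : ℝ}, u ∈ sphere (0 : EuclideanSpace ℝ (Fin n)) 1 → 0 ≤ s → s ≤ 1 →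
      F₁ u + s • (F₂ u - F₁ u) ∈ {z | infDist z M < r} :=
    fun hu hs0 hs1 => infDist_chord_lt hF₁M hd hdr hu hs0 hs1
  rw [outerMap, outerMap, dist_eq_norm, dist_eq_norm]
  calc ‖P (F₁ ux + sPar a x • wx) - P (F₁ uy + sPar a y • wy)‖
      ≤ L * ‖(F₁ ux + sPar a x • wx) - (F₁ uy + sPar a y • wy)‖ := by
        rw [← dist_eq_norm, ← dist_eq_norm]
        exact hPL.dist_le_mul _ (hU hux hsx0 hsx1) _ (hU huy hsy0 hsy1)
    _ ≤ L * ((9 * Λ + 4 * Λ₂ + 2 * d) * ‖x - y‖) := by gcongr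
    _ = (L * (9 * Λ + 4 * Λ₂ + 2 * d) : ℝ≥0) * ‖x - y‖ := by push_cast; ring

/-- **(A.19)**: `f₂^e` is Lipschitz on the whole closed ball with constant `2Λ₁(f₁^e) + L(9Λ₁(f₁^e) + 4Λ₁(f₂) + 2d^M) ≤
(2 + 9L)[Λ₁(f₁^e) + d^M(f₁, f₂) + Λ₁(f₂)]` (inner and outer bounds glued across `|y| = 1 − a`).
[cite: Federbush1988PhaseCellIV, (A.19) p. 341] -/
theorem lipschitzOnWith_extMap (ha0 : 0 < a) (ha1 : a ≤ 1 / 2) (hda : (d : ℝ) ≤ a * (Λ + 2 * d))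
    (hF₁ : LipschitzOnWith Λ F₁ (closedBall 0 1)) (hF₂ : LipschitzOnWith Λ₂ F₂ (sphere 0 1))
    (hF₁M : MapsTo F₁ (closedBall 0 1) M) (hPL : LipschitzOnWith L P {z | infDist z M < r})
    (hPid : ∀ z ∈ M, P z = z)
    (hd : ∀ u ∈ sphere (0 : EuclideanSpace ℝ (Fin n)) 1, ‖F₂ u - F₁ u‖ ≤ d) (hdr : (d : ℝ) < r) :
    LipschitzOnWith (2 * Λ + L * (9 * Λ + 4 * Λ₂ + 2 * d)) (extMap P F₁ F₂ a) (closedBall 0 1) := by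
  refine lipschitzOnWith_closedBall_of_glue (ρ := 1 - a) ?_ ?_
  · exact (lipschitzOnWith_extMap_inner ha0 ha1 hF₁).weaken (by simp)
  · have hout := (lipschitzOnWith_outerMap ha0 ha1 hda hF₁ hF₂ hF₁M hPL hd hdr).weaken
      (show L * (9 * Λ + 4 * Λ₂ + 2 * d) ≤ 2 * Λ + L * (9 * Λ + 4 * Λ₂ + 2 * d) by simp)
    refine LipschitzOnWith.of_dist_le_mul fun x hx y hy => ?_
    rw [extMap_eq_outerMap ha0 ha1 hF₁M hPid hx.1, extMap_eq_outerMap ha0 ha1 hF₁M hPid hy.1]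
    exact hout.dist_le_mul x hx y hy

end Construction

/-! ## 5. Theorem A.2 for uniformly Lipschitz-retractable `M` -/

/-- Transport of the pointwise distance on `∂B` from `d^M` (`ℝ≥0∞`) to real numbers.
[cite: Federbush1988PhaseCellIV, (A.17) p. 341] -/
theorem norm_sub_le_of_supDist_le {X : Type*} {t : ℕ} {M : Set (EuclideanSpace ℝ (Fin t))} {g₁ g₂ : X → ↥M} {d : ℝ≥0}
    (h : supDist g₁ g₂ ≤ d) (x : X) : ‖(g₂ x : EuclideanSpace ℝ (Fin t)) - g₁ x‖ ≤ d := by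
  have h1 : edist (g₁ x) (g₂ x) ≤ d := (edist_le_supDist g₁ g₂ x).trans h
  rw [Subtype.edist_eq, edist_dist, ← ENNReal.ofReal_coe_nnreal,
    ENNReal.ofReal_le_ofReal_iff d.coe_nonneg, dist_eq_norm, norm_sub_rev] at h1
  exact h1

/-- A real pointwise bound gives a bound on `d^M`. [cite: Federbush1988PhaseCellIV, (A.17) p. 341] -/
theorem supDist_le_of_norm_sub_le {X : Type*} {t : ℕ} {M : Set (EuclideanSpace ℝ (Fin t))} {g₁ g₂ : X → ↥M} {c : ℝ}
    (h : ∀ x, ‖(g₁ x : EuclideanSpace ℝ (Fin t)) - g₂ x‖ ≤ c) : supDist g₁ g₂ ≤ ENNReal.ofReal c := by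
  refine iSup_le fun x => ?_
  rw [Subtype.edist_eq, edist_dist, dist_eq_norm]
  exact ENNReal.ofReal_le_ofReal (h x)

/-- A Lipschitz map `B → M` (subtype to subtype) is Lipschitz on `B` as an ambient map, for any ambient representative.
[cite: Federbush1988PhaseCellIV, (11.4) p. 337] -/
theorem lipschitzOnWith_of_subtype {n t : ℕ} {S : Set (EuclideanSpace ℝ (Fin n))} {M : Set (EuclideanSpace ℝ (Fin t))}
    {f : ↥S → ↥M} {K : ℝ≥0} (hf : LipschitzWith K f) {F : EuclideanSpace ℝ (Fin n) → EuclideanSpace ℝ (Fin t)}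
    (hF : ∀ (x : EuclideanSpace ℝ (Fin n)) (hx : x ∈ S), F x = f ⟨x, hx⟩) : LipschitzOnWith K F S := by
  refine LipschitzOnWith.of_dist_le_mul fun x hx y hy => ?_
  rw [hF x hx, hF y hy, ← Subtype.dist_eq]
  have := hf.dist_le_mul ⟨x, hx⟩ ⟨y, hy⟩
  rwa [Subtype.dist_eq ⟨x, hx⟩] at this

end ThmA2

open ThmA2 in
/-- **Theorem A.2 (embedded reading) holds for every uniformly Lipschitz-retractable `M ⊆ Rᵗ`**, with `ε_M = r/2`,
`c₁ = 1 + L`, `c₂ = 2 + 9L`, where `P` is an `L`-Lipschitz retraction of the open `r`-neighbourhood `{y | dist(y, M) < r}` onto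
`M` (`P = id` on `M`).  Proof = print's construction (A.20)–(A.24) (inner rescaling (A.21), outer homotopy (A.22)–(A.24) along
the retracted chord instead of the shortest geodesic, `a = d^M/(Λ₁(f₁^e) + 2d^M)` for print's `Min(d^M/Λ₁(f₁^e), ½)`); the
cases `Λ₁(f₁^e) = ∞` and `d^M(f₁, f₂) = 0` are treated separately.  No cap on `Λ₁` is required.
[cite: Federbush1988PhaseCellIV, Theorem A.2 (A.18)–(A.24) p. 341] -/
theorem thmA2Emb_of_retract {t : ℕ} {M : Set (EuclideanSpace ℝ (Fin t))} {r : ℝ} (hr : 0 < r) {L : ℝ≥0}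
    {P : EuclideanSpace ℝ (Fin t) → EuclideanSpace ℝ (Fin t)} (hPL : LipschitzOnWith L P {y | infDist y M < r})
    (hPM : MapsTo P {y | infDist y M < r} M) (hPid : ∀ y ∈ M, P y = y) (n : ℕ) : ThmA2Emb n t M := by
  classical
  refine ⟨⟨r / 2, by positivity⟩, ?_, 1 + L, 2 + 9 * L, ?_⟩
  · rw [← NNReal.coe_pos]
    exact half_pos hr
  intro f₁ f₂ f₁e hext hδ
  -- real-valued data
  have hδtop : supDist f₁ f₂ ≠ ⊤ := ne_top_of_le_ne_top ENNReal.coe_ne_top hδ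
  set d : ℝ≥0 := (supDist f₁ f₂).toNNReal with hd_def
  have hδd : supDist f₁ f₂ = d := (ENNReal.coe_toNNReal hδtop).symm
  have hdr : (d : ℝ) < r := by
    have h1 : d ≤ ⟨r / 2, by positivity⟩ := by rw [← ENNReal.coe_le_coe, ← hδd]; exact hδ
    have h2 : (d : ℝ) ≤ r / 2 := h1
    linarith
  have hc₂ : (1 : ℝ≥0∞) ≤ (2 + 9 * L : ℝ≥0) := by
    have : (1 : ℝ≥0) ≤ 2 + 9 * L := le_add_of_le_of_nonneg one_le_two zero_le
    exact_mod_cast this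
  have hc₁ : (1 : ℝ≥0∞) ≤ (1 + L : ℝ≥0) := by exact_mod_cast le_self_add
  -- ambient representatives of the three maps
  set F₁ : EuclideanSpace ℝ (Fin n) → EuclideanSpace ℝ (Fin t) :=
    fun x => if h : x ∈ closedBall (0 : EuclideanSpace ℝ (Fin n)) 1 then (f₁e ⟨x, h⟩ : EuclideanSpace ℝ (Fin t)) else 0
    with hF₁_def
  set F₂ : EuclideanSpace ℝ (Fin n) → EuclideanSpace ℝ (Fin t) :=
    fun x => if h : x ∈ sphere (0 : EuclideanSpace ℝ (Fin n)) 1 then (f₂ ⟨x, h⟩ : EuclideanSpace ℝ (Fin t)) else 0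
    with hF₂_def
  have hF₁f : ∀ (x : EuclideanSpace ℝ (Fin n)) (hx : x ∈ closedBall (0 : EuclideanSpace ℝ (Fin n)) 1),
      F₁ x = f₁e ⟨x, hx⟩ := fun x hx => by rw [hF₁_def]; exact dif_pos hx
  have hF₂f : ∀ (x : EuclideanSpace ℝ (Fin n)) (hx : x ∈ sphere (0 : EuclideanSpace ℝ (Fin n)) 1),
      F₂ x = f₂ ⟨x, hx⟩ := fun x hx => by rw [hF₂_def]; exact dif_pos hx
  have hF₁f₁ : ∀ (x : EuclideanSpace ℝ (Fin n)) (hx : x ∈ sphere (0 : EuclideanSpace ℝ (Fin n)) 1),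
      F₁ x = f₁ ⟨x, hx⟩ := fun x hx => by rw [hF₁f x (sphere_subset_closedBall hx), hext ⟨x, hx⟩]
  have hF₁M : MapsTo F₁ (closedBall 0 1) M := fun x hx => by rw [hF₁f x hx]; exact (f₁e ⟨x, hx⟩).2
  have hF₂M : MapsTo F₂ (sphere 0 1) M := fun x hx => by rw [hF₂f x hx]; exact (f₂ ⟨x, hx⟩).2
  have hdist : ∀ u ∈ sphere (0 : EuclideanSpace ℝ (Fin n)) 1, ‖F₂ u - F₁ u‖ ≤ d := fun u hu => by
    rw [hF₂f u hu, hF₁f₁ u hu]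
    exact norm_sub_le_of_supDist_le hδd.le ⟨u, hu⟩
  -- Case 1: `Λ₁(f₁^e) = ∞` — (A.19) is void; glue `f₂` on `∂B` to `f₁^e` inside.
  rcases eq_or_ne (lipConst f₁e) ⊤ with hΛ | hΛ
  · refine ⟨fun x => if h : x.1 ∈ sphere (0 : EuclideanSpace ℝ (Fin n)) 1 then f₂ ⟨x.1, h⟩ else f₁e x,
      fun x => by simp only [dif_pos x.2, Subtype.coe_eta], ?_, ?_⟩
    · calc supDist f₁e _ ≤ supDist f₁ f₂ := by
            refine iSup_le fun x => ?_
            by_cases h : x.1 ∈ sphere (0 : EuclideanSpace ℝ (Fin n)) 1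
            · simp only [dif_pos h]
              rw [show f₁e x = f₁ ⟨x.1, h⟩ from hext ⟨x.1, h⟩]
              exact edist_le_supDist f₁ f₂ ⟨x.1, h⟩
            · simp only [dif_neg h, edist_self]
              exact zero_le
        _ ≤ (1 + L : ℝ≥0) * supDist f₁ f₂ := le_mul_of_one_le_left zero_le hc₁
    · rw [hΛ, top_add, top_add, ENNReal.mul_top (by exact_mod_cast (show (2 + 9 * L : ℝ≥0) ≠ 0 by positivity))]
      exact le_top
  -- `Λ₁(f₁^e) = Λ < ∞`
  set Λ : ℝ≥0 := (lipConst f₁e).toNNReal with hΛ_def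
  have hΛe : lipConst f₁e = Λ := (ENNReal.coe_toNNReal hΛ).symm
  have hf₁eL : LipschitzWith Λ f₁e := lipConst_le_iff.mp hΛe.le
  have hF₁L : LipschitzOnWith Λ F₁ (closedBall 0 1) := lipschitzOnWith_of_subtype hf₁eL hF₁f
  -- Case 2: `d^M(f₁, f₂) = 0` — then `f₂ = f₁`; take `f₂^e = f₁^e`.
  rcases eq_or_ne d 0 with hd0 | hd0
  · have hf₁₂ : ∀ x, f₁ x = f₂ x := fun x => by
      have h := edist_le_supDist f₁ f₂ x
      rw [hδd, hd0, ENNReal.coe_zero, nonpos_iff_eq_zero, edist_eq_zero] at h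
      exact h
    refine ⟨f₁e, fun x => (hext x).trans (hf₁₂ x), ?_, ?_⟩
    · have : supDist f₁e f₁e = 0 := by simp [supDist]
      rw [this]
      exact zero_le
    · calc lipConst f₁e ≤ lipConst f₁e + supDist f₁ f₂ + lipConst f₂ := by
            rw [add_assoc]; exact le_self_add
        _ ≤ (2 + 9 * L : ℝ≥0) * (lipConst f₁e + supDist f₁ f₂ + lipConst f₂) :=
            le_mul_of_one_le_left zero_le hc₂
  -- Case 3 (main): `0 < d^M < r`, `Λ < ∞`: print's construction with `a = d^M/(Λ + 2d^M)`.
  have hdpos : (0 : ℝ) < d := by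
    rcases eq_or_lt_of_le d.2 with h | h
    · exact absurd (NNReal.coe_eq_zero.mp h.symm) hd0
    · exact h
  set a : ℝ := d / (Λ + 2 * d) with ha_def
  have hden : (0 : ℝ) < Λ + 2 * d := by positivity
  have ha0 : 0 < a := div_pos hdpos hden
  have ha1 : a ≤ 1 / 2 := by
    rw [ha_def, div_le_iff₀ hden]
    have : (0 : ℝ) ≤ Λ := Λ.2
    linarith
  have hΛa : (Λ : ℝ) * a ≤ d := by
    rw [ha_def, mul_div_assoc', div_le_iff₀ hden]
    have : (0 : ℝ) ≤ Λ := Λ.2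
    nlinarith
  have hda : (d : ℝ) ≤ a * (Λ + 2 * d) := by rw [ha_def, div_mul_cancel₀ _ hden.ne']
  -- the extension
  set g := extMap P F₁ F₂ a with hg_def
  have hgM : ∀ x : ↥(closedBall (0 : EuclideanSpace ℝ (Fin n)) 1), g x.1 ∈ M := fun x =>
    extMap_mem ha0 ha1 hF₁M hPM hdist hdr (mem_closedBall_zero_iff.mp x.2)
  refine ⟨fun x => ⟨g x.1, hgM x⟩, fun x => ?_, ?_, ?_⟩
  · -- extension of `f₂`
    apply Subtype.ext
    show g x.1 = f₂ x
    rw [hg_def, extMap_of_norm_eq_one ha0 hF₂M hPid (mem_sphere_zero_iff_norm.mp x.2), hF₂f x.1 x.2]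
  · -- (A.18)
    have hpt : ∀ x : ↥(closedBall (0 : EuclideanSpace ℝ (Fin n)) 1),
        ‖(f₁e x : EuclideanSpace ℝ (Fin t)) - g x.1‖ ≤ (1 + L) * d := fun x => by
      rw [← hF₁f x.1 x.2, ← dist_eq_norm, hg_def]
      exact dist_extMap_le ha0 ha1 hΛa hF₁L hF₁M hPL hPid hdist hdr (mem_closedBall_zero_iff.mp x.2)
    calc supDist f₁e (fun x => ⟨g x.1, hgM x⟩) ≤ ENNReal.ofReal ((1 + L) * d) := supDist_le_of_norm_sub_le hpt
      _ = (1 + L : ℝ≥0) * supDist f₁ f₂ := by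
          rw [hδd, show ((1 : ℝ) + L) * d = ((1 + L) * d : ℝ≥0) by push_cast; ring, ENNReal.ofReal_coe_nnreal]
          push_cast
          ring
  · -- (A.19)
    rcases eq_or_ne (lipConst f₂) ⊤ with hΛ₂ | hΛ₂
    · rw [hΛ₂, add_top, ENNReal.mul_top (by exact_mod_cast (show (2 + 9 * L : ℝ≥0) ≠ 0 by positivity))]
      exact le_top
    set Λ₂ : ℝ≥0 := (lipConst f₂).toNNReal with hΛ₂_def
    have hΛ₂e : lipConst f₂ = Λ₂ := (ENNReal.coe_toNNReal hΛ₂).symm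
    have hf₂L : LipschitzWith Λ₂ f₂ := lipConst_le_iff.mp hΛ₂e.le
    have hF₂L : LipschitzOnWith Λ₂ F₂ (sphere 0 1) := lipschitzOnWith_of_subtype hf₂L hF₂f
    have hgL := lipschitzOnWith_extMap ha0 ha1 hda hF₁L hF₂L hF₁M hPL hPid hdist hdr
    have hg' : LipschitzWith (2 * Λ + L * (9 * Λ + 4 * Λ₂ + 2 * d))
        (fun x : ↥(closedBall (0 : EuclideanSpace ℝ (Fin n)) 1) => (⟨g x.1, hgM x⟩ : ↥M)) := by
      refine LipschitzWith.of_dist_le_mul fun x y => ?_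
      rw [Subtype.dist_eq, Subtype.dist_eq x]
      exact hgL.dist_le_mul x.1 x.2 y.1 y.2
    calc lipConst (fun x : ↥(closedBall (0 : EuclideanSpace ℝ (Fin n)) 1) => (⟨g x.1, hgM x⟩ : ↥M))
        ≤ (2 * Λ + L * (9 * Λ + 4 * Λ₂ + 2 * d) : ℝ≥0) := lipConst_le_of_lipschitzWith hg'
      _ ≤ ((2 + 9 * L) * (Λ + d + Λ₂) : ℝ≥0) := by
          gcongr
          rw [← NNReal.coe_le_coe]
          push_cast
          have h1 : (0 : ℝ) ≤ Λ := Λ.2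
          have h2 : (0 : ℝ) ≤ Λ₂ := Λ₂.2
          have h3 : (0 : ℝ) ≤ L := L.2
          nlinarith
      _ = (2 + 9 * L : ℝ≥0) * (lipConst f₁e + supDist f₁ f₂ + lipConst f₂) := by
          rw [hΛe, hδd, hΛ₂e]
          push_cast
          ring

/-! ## 6. Model instance: the round sphere `S^{t−1} ⊂ ℝᵗ` (in particular `U(1) = S¹`, `SU(2) ≅ S³`) -/

/-- The radial projection `y ↦ y/|y|` is a `4`-Lipschitz retraction of the `½`-neighbourhood of the unit sphere `S^{t−1} ⊂ ℝᵗ`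
(`t ≥ 1`) onto the sphere. [cite: Federbush1988PhaseCellIV, Theorem A.2 p. 341; p. 342] -/
theorem ThmA2.radial_retraction_sphere {t : ℕ} (ht : 1 ≤ t) :
    LipschitzOnWith 4 (radial : EuclideanSpace ℝ (Fin t) → EuclideanSpace ℝ (Fin t))
        {y | infDist y (sphere (0 : EuclideanSpace ℝ (Fin t)) 1) < 1 / 2} ∧
      MapsTo radial {y | infDist y (sphere (0 : EuclideanSpace ℝ (Fin t)) 1) < 1 / 2}
        (sphere (0 : EuclideanSpace ℝ (Fin t)) 1) ∧
      ∀ y ∈ sphere (0 : EuclideanSpace ℝ (Fin t)) 1, radial y = y := by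
  have hnorm : ∀ y : EuclideanSpace ℝ (Fin t), infDist y (sphere (0 : EuclideanSpace ℝ (Fin t)) 1) < 1 / 2 →
      1 / 2 < ‖y‖ := by
    intro y hy
    have h := le_infDist_sphere ht 0 y
    rw [sub_zero] at h
    linarith
  refine ⟨?_, fun y hy => ?_, fun y hy => radial_of_norm_eq_one (by simpa using hy)⟩
  · refine LipschitzOnWith.of_dist_le_mul fun x hx y hy => ?_
    rw [dist_eq_norm, dist_eq_norm]
    have h := norm_radial_sub_radial_le (x := x) (y := y) (ρ := 1 / 2) (by norm_num) (hnorm x hx).le (hnorm y hy).le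
    norm_num at h
    exact_mod_cast h
  · have hy0 : y ≠ 0 := by
      intro h0
      have := hnorm y hy
      rw [h0, norm_zero] at this
      linarith
    rw [mem_sphere_zero_iff_norm, norm_radial hy0]

/-- **Theorem A.2 (embedded reading) for the MODEL INSTANCE `M = S^{t−1}`**, the unit sphere of `ℝᵗ`, hypothesis-free, for every
ball dimension `n` and every `t` (`ε_M = ¼`, `c₁ = 5`, `c₂ = 38`; for `t = 0` the sphere is empty and the statement is void).
[cite: Federbush1988PhaseCellIV, Theorem A.2 (A.18)–(A.19) p. 341] -/
theorem thmA2Emb_sphere (n t : ℕ) : ThmA2Emb n t (sphere (0 : EuclideanSpace ℝ (Fin t)) 1) := by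
  rcases Nat.lt_or_ge t 1 with ht | ht
  · have ht0 : t = 0 := by omega
    subst ht0
    refine ⟨1, one_pos, 1, 1, fun f₁ f₂ f₁e _ _ => ?_⟩
    exfalso
    have hmem : (0 : EuclideanSpace ℝ (Fin n)) ∈ closedBall (0 : EuclideanSpace ℝ (Fin n)) 1 := by simp
    have h1 := (f₁e ⟨0, hmem⟩).2
    rw [mem_sphere_zero_iff_norm] at h1
    have h0 : ‖((f₁e ⟨0, hmem⟩ : ↥(sphere (0 : EuclideanSpace ℝ (Fin 0)) 1)) : EuclideanSpace ℝ (Fin 0))‖ = 0 := by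
      rw [EuclideanSpace.norm_eq, Fin.sum_univ_zero, Real.sqrt_zero]
    rw [h0] at h1
    exact zero_ne_one h1
  · obtain ⟨hL, hM, hid⟩ := ThmA2.radial_retraction_sphere ht
    exact thmA2Emb_of_retract (by norm_num : (0 : ℝ) < 1 / 2) hL hM hid n

/-- `U(1) = S¹ ⊂ ℝ² = ℂ`: Theorem A.2 (embedded reading) for maps into the circle, every ball dimension `n`.
[cite: Federbush1988PhaseCellIV, Theorem A.2 p. 341] -/
theorem thmA2Emb_circle (n : ℕ) : ThmA2Emb n 2 (sphere (0 : EuclideanSpace ℝ (Fin 2)) 1) :=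
  thmA2Emb_sphere n 2

/-- `SU(2) ≅ S³ ⊂ ℝ⁴ = ℍ`: Theorem A.2 (embedded reading) for maps into the three-sphere, every ball dimension `n`.
[cite: Federbush1988PhaseCellIV, Theorem A.2 p. 341] -/
theorem thmA2Emb_threeSphere (n : ℕ) : ThmA2Emb n 4 (sphere (0 : EuclideanSpace ℝ (Fin 4)) 1) :=
  thmA2Emb_sphere n 4

end PhaseCellIVAppA

end

end Literature.MathematicalPhysics.QuantumFieldTheory.Federbush1986
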